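import Summits.HodgeConjecture.HodgeConjecture.Theorems.Ring2AbelianAllAndreInvariantHomNumRank
import Summits.HodgeConjecture.HodgeConjecture.Theorems.Ring2AbelianAllAndreFibreGysinRational
import HarnessLib

/-!
# Ring 2 · sub-cell AbelianAll (ALL ABELIAN VARIETIES), André axis, part XXX-e — THE ATOMS HOLD AT A FIBRE SATISFYING `HC^q`:
# `HC^q(X_t) ⟹ FibAlg_t(q) ∧ InvProj_t(q)`; hence at such a fibre `(Num_t)(p,q) ⟺ (L)_t(p) ⟺ (Num₂)(t,q)` and
# `Div[t,q] ⟺ (L)_t(q)` — the Hodge conjecture on the fibre is needed in the ONE degree `2q` only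

HONEST FRAMING (page 1, verbatim): **research route, not a corollary; conditional on HC_CM plus one named
minimal statement.** Cell line: research route conditional on HC_CM; not a corollary; Q11.4-sentence-2
already refuted in dim ≥ 3. Nothing in this file proves a case of the Hodge conjecture for an abelian variety;
`HC_CM` (`Theses.RankFourFaces.CMAbelianHodge`) does not occur in this file (the Hodge conjecture for ONE fibre in ONE degree,
`HC^q(X_t)`, is an explicit hypothesis of the rows of §3–§4); item `Theses.RankFourFaces.CMToAbelian` (stmt-HodgeConjecture-16267)
OPEN and not closed here. Seat `pub-hodge-ring2-ab-andre-2`, gen 22; brief (ii). Sequel of parts XXX-a…d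
(`Ring2AbelianAllAndreInvariantHomNum[Division|Atoms|Rank]`).

## What is proved (theorems only; no definition, no named fact, no sorry; brackets are `local notation3`)

§1 **`comap_le_span_isRationalClass_of_linearMap`** — RATIONAL PREIMAGES: for `X` smooth projective and ANY `ℂ`-linear
`T : Hᵏ(X(ℂ); ℂ) → Hˡ(Y(ℂ); ℂ)` taking rational classes to rational classes, the preimage `T⁻¹ A` of a subspace `A` spanned by its
rational classes is spanned by its rational classes (part XVII-b's `comap_complexBetti_map_le_span_isRationalClass` is the case
`T = g^*`; the `ℚ`-form of `T` is built as in part XXIX-h §1; the base change step is part XVII-b's `mem_baseChange_comap_iff`).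
§2 **`fibAlg_of_hodgeClassesAlgebraic`** — `HC^q(X_t) ⟹ FibAlg_t(q)`: the classes `x` with `L_t x ∈ N^{q+1}(𝒳)` are combinations of
RATIONAL such `x'` (§1 for `T = L_t = j_{t*} j_t^*`, which preserves rationality, part X-b), and `j_t^* x'` is a rational `(q,q)`-class
(part XXIX-g: `j_{t*}` detects the Hodge type on `Im j_t^*`), algebraic by `HC^q(X_t)`. **`invProj_of_hodgeClassesAlgebraic`** —
`HC^q(X_t) ⟹ InvProj_t(q)`: for a rational algebraic `c`, `j_{t*} c = L_t x₀` with `x₀` rational (parts XXVII-b, XXIX-h), and `j_t^* x₀` is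
a rational `(q,q)`-class, algebraic; linearity.
§3 AT A FIBRE SATISFYING `HC^q` ALL THE ANDRÉ-AXIS HYPOTHESES IN THE PAIR OF DEGREES `(2p, 2q+2)` ARE THE LIFT (`p + q = d`):
**`numerical_iff_comap_le_sup_of_hodgeClassesAlgebraic`** (`(Num_t)(p,q) ⟺ (L)_t(p)`; part XVIII-c needed `HC^p ∧ HC^q`),
**`numerical₂_iff_comap_le_sup_of_hodgeClassesAlgebraic`** (`(Num₂)(t,q) ⟺ (L)_t(p)`),
**`fibreClassDivisionAt_iff_comap_le_sup_of_hodgeClassesAlgebraic`** (`Div[t,q] ⟺ (L)_t(q)`; part XXIX-e needed `HC^p ∧ HC^q` and the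
lift in the other degree). §4 the same at CM fibres under `HC_CM` is parts XVIII-c / XXIX-e (not restated).

References: VoisinHodgeI2002 (§7.1.1, §11.3.3 Lemma 11.41); HatcherAT2002 (§3.1 Thm. 3.2 and p. 198); Kleiman1968AlgebraicCycles (§3);
DeligneHodgeII1971 (Thm. 4.1.1, (4.1.3.1)); GrothendieckTopology1969 (§1); Milne2020HodgeClassesAV (Prop. 1 p. 7); Andre1996Motifs (§5.1, §6.3).
-/

noncomputable section

set_option linter.dupNamespace false

open scoped TensorProduct

namespace Summit.HodgeConjecture.HodgeConjecture.Ring2.AbelianAll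

open CategoryTheory AlgebraicGeometry
open Literature.AlgebraicGeometry Literature.AlgebraicGeometry.Motives
open Literature.AlgebraicGeometry.HodgeTheory
open Literature.AlgebraicTopology.SingularHomology (singularCohomology cupProduct cupProduct_gradedComm_holds)

/-! ## §1 Rational preimages under a rationality-preserving linear map -/

section Rational

variable {n k l : ℕ} {X Y : SchemeOver ℂ}

/-- **THE PREIMAGE OF A RATIONALLY SPANNED SUBSPACE UNDER A RATIONALITY-PRESERVING LINEAR MAP IS RATIONALLY SPANNED.** Let `X` be
smooth projective, `T : Hᵏ(X(ℂ); ℂ) → Hˡ(Y(ℂ); ℂ)` a `ℂ`-linear map taking rational classes to rational classes, and `A ⊆ Hˡ(Y(ℂ); ℂ)`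
a subspace contained in the span of its rational classes. Then every `W` with `T W ∈ A` is a `ℂ`-combination of RATIONAL classes `W'`
with `T W' ∈ A`. (`T` has a `ℚ`-form `G` with `T ∘ β_X = β_Y ∘ (G ⊗ ℂ)`, `β = ofRatClassBaseChange` onto for `X` and into for `Y`; then
`(G⁻¹ A_ℚ) ⊗ ℂ = (G ⊗ ℂ)⁻¹ (A_ℚ ⊗ ℂ)` by flatness of `ℂ/ℚ`.) [cite: VoisinHodgeI2002, §7.1.1] [cite: HatcherAT2002, §3.1 Thm. 3.2 and p. 198] -/
theorem comap_le_span_isRationalClass_of_linearMap (hX : IsSmoothProjective n X)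
    (T : complexBetti X k →ₗ[ℂ] complexBetti Y l) (hT : ∀ c, IsRationalClass c → IsRationalClass (T c))
    (A : Submodule ℂ (complexBetti Y l))
    (hA : A ≤ Submodule.span ℂ {c : complexBetti Y l | IsRationalClass c ∧ c ∈ A})
    {W : complexBetti X k} (hW : T W ∈ A) :
    W ∈ Submodule.span ℂ {W' : complexBetti X k | IsRationalClass W' ∧ T W' ∈ A} := by
  set βX := ofRatClassBaseChange (ComplexPoints X) k with hβX
  set βY := ofRatClassBaseChange (ComplexPoints Y) l with hβY
  -- the `ℚ`-form `G` of `T`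
  have hex : ∀ a : bettiCohomology X k, ∃ b : bettiCohomology Y l,
      ofRatClass (ComplexPoints Y) l b = T (ofRatClass (ComplexPoints X) k a) := fun a ↦ by
    obtain ⟨b, hb⟩ := (isRationalClass_iff_mem_range_ofRatClass _).1 (hT _ (isRationalClass_ofRatClass a))
    exact ⟨b, hb⟩
  choose g hg using hex
  let G : bettiCohomology X k →ₗ[ℚ] bettiCohomology Y l :=
    { toFun := g
      map_add' := fun a b ↦ ofRatClass_injective l (by
        rw [hg, map_add, map_add, map_add, hg, hg])
      map_smul' := fun q a ↦ ofRatClass_injective l (by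
        change ofRatClass _ l (g (q • a)) = ofRatClass _ l (q • g a)
        rw [hg, Motives.ofRatClass_smul, Motives.ofRatClass_smul, map_smul, hg]) }
  have hG : ∀ a, ofRatClass (ComplexPoints Y) l (G a) = T (ofRatClass (ComplexPoints X) k a) := hg
  -- naturality `T ∘ β_X = β_Y ∘ (G ⊗ ℂ)`
  have hnat : ∀ t, T (βX t) = βY (G.baseChange ℂ t) := by
    intro t
    induction t using TensorProduct.induction_on with
    | zero => simp only [map_zero]
    | tmul c a =>
      rw [hβX, hβY, ofRatClassBaseChange_tmul, LinearMap.baseChange_tmul, ofRatClassBaseChange_tmul, map_smul, hG]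
    | add x y hx hy => rw [map_add, map_add, hx, hy, map_add, map_add]
  -- the `ℚ`-form of `A`
  let Aℚ : Submodule ℚ (bettiCohomology Y l) :=
    ((A.comap βY).restrictScalars ℚ).comap HodgeStructure.ofRat
  have hAℚ : ∀ a : bettiCohomology Y l, a ∈ Aℚ ↔ ofRatClass (ComplexPoints Y) l a ∈ A := fun a ↦ by
    change βY (HodgeStructure.ofRat a) ∈ A ↔ _
    rw [hβY, ofRatClassBaseChange_ofRat]
  -- `β_Y⁻¹ A ⊆ A_ℚ ⊗ ℂ`
  have h1 : ∀ x, βY x ∈ A → x ∈ Aℚ.baseChange ℂ := by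
    intro x hx
    have hle : Submodule.span ℂ {c : complexBetti Y l | IsRationalClass c ∧ c ∈ A} ≤
        (Aℚ.baseChange ℂ).map βY := by
      refine Submodule.span_le.2 ?_
      rintro c ⟨hc, hcA⟩
      obtain ⟨a, rfl⟩ := (isRationalClass_iff_mem_range_ofRatClass c).1 hc
      refine ⟨HodgeStructure.ofRat a, ?_, by rw [hβY, ofRatClassBaseChange_ofRat]⟩
      rw [HodgeStructure.ofRat_apply]
      exact Submodule.tmul_mem_baseChange_of_mem 1 ((hAℚ a).2 hcA)
    obtain ⟨y, hy, hyx⟩ := hle (hA hx)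
    rwa [← ofRatClassBaseChange_injective _ l hyx]
  -- write `W = β_X τ` and move through naturality
  obtain ⟨τ, rfl⟩ := ofRatClassBaseChange_surjective hX k W
  have hτ : τ ∈ (Aℚ.comap G).baseChange ℂ := by
    rw [mem_baseChange_comap_iff]
    exact h1 _ (by rw [← hnat]; exact hW)
  -- the generators `1 ⊗ w`, `G w ∈ A_ℚ`, go to rational classes `w ⊗ 1` with `T (w ⊗ 1) ∈ A`
  rw [Submodule.baseChange_eq_span] at hτ
  have hmap : βX τ ∈
      (Submodule.span ℂ ((Aℚ.comap G).map (TensorProduct.mk ℚ ℂ (bettiCohomology X k) 1) :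
        Set (ℂ ⊗[ℚ] bettiCohomology X k))).map βX :=
    Submodule.mem_map_of_mem hτ
  rw [Submodule.map_span] at hmap
  refine Submodule.span_mono ?_ hmap
  rintro _ ⟨_, ⟨w, hw, rfl⟩, rfl⟩
  have hw' : ofRatClass (ComplexPoints Y) l (G w) ∈ A := (hAℚ _).1 (Submodule.mem_comap.1 hw)
  refine ⟨?_, ?_⟩
  · change IsRationalClass (βX ((1 : ℂ) ⊗ₜ[ℚ] w))
    rw [hβX, ofRatClassBaseChange_tmul, one_smul]
    exact isRationalClass_ofRatClass w
  · change T (βX ((1 : ℂ) ⊗ₜ[ℚ] w)) ∈ A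
    rw [hβX, ofRatClassBaseChange_tmul, one_smul, ← hG]
    exact hw'

end Rational

variable {𝒳 S : SchemeOver ℂ} {d : ℕ} {f : 𝒳 ⟶ S}

/-- (Div) `Div[hf, t, p]` — division by the fibre class at `t` in degree `2p` (part XXIX-c's display-only bracket, restated verbatim):
`L_t⁻¹ N^{p+1}(𝒳) ≤ N^p(𝒳) + ker j_t^*`, `L_t = j_{t*} j_t^*`. [cite: Grothendieck1968, §3 p. 196 (A(X, L))]
[cite: Abdulali1994FamiliesAV, Conjecture 5.3 (p. 1130)] -/
local notation3 "Div[" hf ", " t ", " p "]" =>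
  Submodule.comap ((fiberGysin hf t p) ∘ₗ (complexBetti.map (fiberι f t) (2 * p)).hom) (algebraicClasses 𝒳 (p + 1)) ≤
    algebraicClasses 𝒳 p ⊔ LinearMap.ker (complexBetti.map (fiberι f t) (2 * p)).hom

/-- (FibAlg) `FibAlg[hf, t, q]` — "an invariant class whose fibre-class multiple is algebraic on `𝒳` is algebraic on the fibre"
(part XXX-c's display-only bracket, restated verbatim): `L_t⁻¹ N^{q+1}(𝒳) ≤ (j_t^*)⁻¹ N^q(X_t)`. [cite: Kleiman1968AlgebraicCycles, §3 (D(X))] -/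
local notation3 "FibAlg[" hf ", " t ", " q "]" =>
  Submodule.comap ((fiberGysin hf t q) ∘ₗ (complexBetti.map (fiberι f t) (2 * q)).hom) (algebraicClasses 𝒳 (q + 1)) ≤
    (algebraicClasses (fiberOver f t) q).comap (complexBetti.map (fiberι f t) (2 * q)).hom

/-- (InvProj) `InvProj[hf, t, q]` — "every algebraic class of the fibre is Gysin-equivalent to an INVARIANT algebraic class"
(part XXX-c's display-only bracket, restated verbatim). [cite: DeligneHodgeII1971, Thm. 4.1.1] -/
local notation3 "InvProj[" hf ", " t ", " q "]" =>
  ∀ b ∈ algebraicClasses (fiberOver f t) q,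
    ∃ b' ∈ algebraicClasses (fiberOver f t) q ⊓ LinearMap.range (complexBetti.map (fiberι f t) (2 * q)).hom,
      fiberGysin hf t q b' = fiberGysin hf t q b

/-! ## §2 The atoms at a fibre satisfying `HC^q` -/

/-- **`HC^q(X_t) ⟹ FibAlg_t(q)`**: if the rational `(q,q)`-classes of the fibre `X_t` are algebraic, then every global `x` whose
fibre-class multiple `L_t x = x ∪ [X_t]` is algebraic on `𝒳` restricts to an algebraic class of `X_t`. The classes with `L_t x`
algebraic are combinations of RATIONAL such classes (§1 for `T = L_t`, which preserves rationality — part X-b — and `A = N^{q+1}(𝒳)`,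
spanned by its rational classes — Grothendieck); for rational `x'`, `j_t^* x'` is rational and of type `(q,q)` (part XXIX-g), hence
algebraic. [cite: VoisinHodgeI2002, §7.1.1 and §11.3.3 Lemma 11.41] [cite: GrothendieckTopology1969, §1] [cite: DeligneHodgeII1971, (4.1.3.1)] -/
theorem fibAlg_of_hodgeClassesAlgebraic (hf : IsCompactAbelianPencil f d) (t : ComplexPoints S) (q : ℕ)
    (hq : ∀ c : complexBetti (fiberOver f t) (2 * q), IsRationalClass c →
      IsOfHodgeType d (fiberOver f t) (2 * q) q q c → c ∈ algebraicClasses (fiberOver f t) q) :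
    FibAlg[hf, t, q] := by
  have h𝒳 := hf.isSmoothProjective_total
  intro x hx
  have hx' : ((fiberGysin hf t q) ∘ₗ (complexBetti.map (fiberι f t) (2 * q)).hom) x ∈ algebraicClasses 𝒳 (q + 1) := hx
  have hspan := comap_le_span_isRationalClass_of_linearMap h𝒳
    ((fiberGysin hf t q) ∘ₗ (complexBetti.map (fiberι f t) (2 * q)).hom)
    (fun c hc ↦ isRationalClass_fiberGysin_map_fiberι hf t hc) (algebraicClasses 𝒳 (q + 1))
    (supportedClasses_le_span_isRationalClass h𝒳 (2 * (q + 1)) (q + 1)) hx'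
  refine (Submodule.span_le (p := (algebraicClasses (fiberOver f t) q).comap
    (complexBetti.map (fiberι f t) (2 * q)).hom)).2 ?_ hspan
  rintro x' ⟨hx'Q, hx'A⟩
  have hx'A' : fiberGysin hf t q (complexBetti.map (fiberι f t) (2 * q) x') ∈ algebraicClasses 𝒳 (q + 1) := hx'A
  exact hq _ (hx'Q.map (AlgPoints.mapContinuous (L := ℂ) (fiberι f t)))
    (isOfHodgeType_map_fiberι_of_fiberGysin_mem_algebraicClasses hf t hx'A')

/-- **`HC^q(X_t) ⟹ InvProj_t(q)`**: if the rational `(q,q)`-classes of `X_t` are algebraic, every algebraic class `b` of degree `2q` on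
`X_t` is Gysin-equivalent to an invariant algebraic class. For RATIONAL algebraic `c`: `j_{t*} c = L_t x` for some `x` (part XXVII-b),
`L_t x` is rational, so `j_t^* x = j_t^* x₀` with `x₀` rational (part XXIX-h), and `j_t^* x₀` is a rational `(q,q)`-class (its fibre-class
multiple `j_{t*} c` is algebraic, part XXIX-g), hence algebraic; the algebraic classes are spanned by the rational ones (Grothendieck) and
the conclusion is linear in `b`. [cite: DeligneHodgeII1971, Thm. 4.1.1 and (4.1.3.1)] [cite: VoisinHodgeI2002, §7.1.1]
[cite: GrothendieckTopology1969, §1] -/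
theorem invProj_of_hodgeClassesAlgebraic (hf : IsCompactAbelianPencil f d) (t : ComplexPoints S) (q : ℕ)
    (hq : ∀ c : complexBetti (fiberOver f t) (2 * q), IsRationalClass c →
      IsOfHodgeType d (fiberOver f t) (2 * q) q q c → c ∈ algebraicClasses (fiberOver f t) q) :
    InvProj[hf, t, q] := by
  have h𝒳 := hf.isSmoothProjective_total
  have hXt := hf.isSmoothProjective_fiberOver t
  intro b hb
  have hb' := supportedClasses_le_span_isRationalClass hXt (2 * q) q hb
  clear hb
  induction hb' using Submodule.span_induction with
  | mem c hc =>
    obtain ⟨hcQ, hcN⟩ := hc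
    obtain ⟨x, hx⟩ := exists_mem_range_fiberGysin_eq hf t q c
    have hrat : IsRationalClass (fiberGysin hf t q (complexBetti.map (fiberι f t) (2 * q) x)) := by
      rw [hx]
      exact isRationalClass_complexGysin_complexOrientationFamily hXt h𝒳 (fiberι f t) _ hcQ
    obtain ⟨x₀, hx₀, hx₀x⟩ := exists_isRationalClass_map_fiberι_eq_of_fiberGysin hf t hrat
    have halg : fiberGysin hf t q (complexBetti.map (fiberι f t) (2 * q) x₀) ∈ algebraicClasses 𝒳 (q + 1) := by
      rw [hx₀x, hx]
      exact fiberGysin_mem_algebraicClasses hf t hcN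
    refine ⟨complexBetti.map (fiberι f t) (2 * q) x₀, ⟨hq _ (hx₀.map (AlgPoints.mapContinuous (L := ℂ) (fiberι f t)))
      (isOfHodgeType_map_fiberι_of_fiberGysin_mem_algebraicClasses hf t halg), ⟨x₀, rfl⟩⟩, ?_⟩
    rw [hx₀x, hx]
  | zero => exact ⟨0, Submodule.zero_mem _, rfl⟩
  | add c c' _ _ hc hc' =>
    obtain ⟨b₁, hb₁, h₁⟩ := hc
    obtain ⟨b₂, hb₂, h₂⟩ := hc'
    exact ⟨b₁ + b₂, Submodule.add_mem _ hb₁ hb₂, by rw [map_add, map_add, h₁, h₂]⟩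
  | smul a c _ hc =>
    obtain ⟨b₁, hb₁, h₁⟩ := hc
    exact ⟨a • b₁, Submodule.smul_mem _ a hb₁, by rw [map_smul, map_smul, h₁]⟩

/-! ## §3 At a fibre satisfying `HC^q`, every hypothesis in the degrees `(2p, 2q+2)` is the lift -/

/-- **`HC^q(X_t) ⊢ (Num_t)(p,q) ⟺ (L)_t(p)`** (`p + q = d`): part XXX-c's `(Num_t)(p,q) ⟺ (L)_t(p) ∧ InvProj_t(q)` with §2. Part XVIII-c's
`numerical_iff_comap_le_sup_of_hodge` needed the Hodge conjecture for `X_t` in BOTH degrees `2p` and `2q`; here `2q` alone.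
[cite: Kleiman1968AlgebraicCycles, §3 (D(X))] [cite: Milne2020HodgeClassesAV, Prop. 1 (p. 7)] -/
theorem numerical_iff_comap_le_sup_of_hodgeClassesAlgebraic (hf : IsCompactAbelianPencil f d) (t : ComplexPoints S)
    {p q : ℕ} (hpq : p + q = d)
    (hq : ∀ c : complexBetti (fiberOver f t) (2 * q), IsRationalClass c →
      IsOfHodgeType d (fiberOver f t) (2 * q) q q c → c ∈ algebraicClasses (fiberOver f t) q) :
    (∀ b ∈ algebraicClasses (fiberOver f t) q,
        (∀ a ∈ algebraicClasses 𝒳 p,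
          cupProduct (show 2 * p + 2 * (q + 1) = 2 * (d + 1) by omega) a (fiberGysin hf t q b) = 0) →
          fiberGysin hf t q b = 0) ↔
      (algebraicClasses (fiberOver f t) p).comap (complexBetti.map (fiberι f t) (2 * p)).hom ≤
        algebraicClasses 𝒳 p ⊔ LinearMap.ker (complexBetti.map (fiberι f t) (2 * p)).hom := by
  rw [numerical_iff_comap_le_sup_and_invProj hf t hpq]
  exact ⟨fun h ↦ h.1, fun h ↦ ⟨h, invProj_of_hodgeClassesAlgebraic hf t q hq⟩⟩

/-- **`HC^q(X_t) ⊢ (Num₂)(t,q) ⟺ (L)_t(p)`** (`p + q = d`): at a fibre whose rational `(q,q)`-classes are algebraic, "an algebraic class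
`x ∪ [X_t] ∈ N^{q+1}(𝒳)` cup-orthogonal to `N^p(𝒳)` vanishes" IS the lift in the complementary degree `2p` (part XXX-c's
`(Num₂)(t,q) ⟺ (L)_t(p) ∧ FibAlg_t(q)` with §2). [cite: Kleiman1968AlgebraicCycles, §3 (D(X))] [cite: Lieberman1968, main theorem] -/
theorem numerical₂_iff_comap_le_sup_of_hodgeClassesAlgebraic (hf : IsCompactAbelianPencil f d) (t : ComplexPoints S)
    {p q : ℕ} (hpq : p + q = d)
    (hq : ∀ c : complexBetti (fiberOver f t) (2 * q), IsRationalClass c →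
      IsOfHodgeType d (fiberOver f t) (2 * q) q q c → c ∈ algebraicClasses (fiberOver f t) q) :
    (∀ x : complexBetti 𝒳 (2 * q),
        fiberGysin hf t q (complexBetti.map (fiberι f t) (2 * q) x) ∈ algebraicClasses 𝒳 (q + 1) →
        (∀ w ∈ algebraicClasses 𝒳 p, cupProduct (show 2 * (q + 1) + 2 * p = 2 * (d + 1) by omega)
            (fiberGysin hf t q (complexBetti.map (fiberι f t) (2 * q) x)) w = 0) →
          fiberGysin hf t q (complexBetti.map (fiberι f t) (2 * q) x) = 0) ↔
      (algebraicClasses (fiberOver f t) p).comap (complexBetti.map (fiberι f t) (2 * p)).hom ≤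
        algebraicClasses 𝒳 p ⊔ LinearMap.ker (complexBetti.map (fiberι f t) (2 * p)).hom := by
  rw [numerical₂_iff_comap_le_sup_and_fibAlg hf t hpq]
  exact ⟨fun h ↦ h.1, fun h ↦ ⟨h, fibAlg_of_hodgeClassesAlgebraic hf t q hq⟩⟩

/-- **`HC^q(X_t) ⊢ Div[t,q] ⟺ (L)_t(q)`**: at a fibre whose rational `(q,q)`-classes are algebraic, division by the fibre class in degree
`2q` IS the lift in degree `2q` (part XXX-d's `Div[t,q] ⟺ (L)_t(q) ∧ FibAlg_t(q)` with §2). Part XXIX-e's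
`fibreClassDivisionAt_iff_comap_le_sup_of_hodge` needed `HC^p ∧ HC^q` and the lift in the complementary degree as well.
[cite: Grothendieck1968, §3 p. 196] [cite: Milne2020HodgeClassesAV, Prop. 1 (p. 7)] -/
theorem fibreClassDivisionAt_iff_comap_le_sup_of_hodgeClassesAlgebraic (hf : IsCompactAbelianPencil f d) (t : ComplexPoints S)
    (q : ℕ)
    (hq : ∀ c : complexBetti (fiberOver f t) (2 * q), IsRationalClass c →
      IsOfHodgeType d (fiberOver f t) (2 * q) q q c → c ∈ algebraicClasses (fiberOver f t) q) :
    Div[hf, t, q] ↔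
      (algebraicClasses (fiberOver f t) q).comap (complexBetti.map (fiberι f t) (2 * q)).hom ≤
        algebraicClasses 𝒳 q ⊔ LinearMap.ker (complexBetti.map (fiberι f t) (2 * q)).hom := by
  rw [fibreClassDivisionAt_iff_comap_le_sup_and_fibAlg hf t q]
  exact ⟨fun h ↦ h.1, fun h ↦ ⟨h, fibAlg_of_hodgeClassesAlgebraic hf t q hq⟩⟩

/-- **`HC^q(X_t) ⊢ (Num₂)(t,q) ⟺ (Num_t)(p,q)`** (`p + q = d`): the two "hom ≡ num for fibre-class-divisible classes" hypotheses of parts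
XVIII and XXIX coincide at a fibre satisfying the Hodge conjecture in degree `2q` (both are the lift in degree `2p`).
[cite: Kleiman1968AlgebraicCycles, §3 (D(X))] -/
theorem numerical₂_iff_numerical_of_hodgeClassesAlgebraic (hf : IsCompactAbelianPencil f d) (t : ComplexPoints S)
    {p q : ℕ} (hpq : p + q = d)
    (hq : ∀ c : complexBetti (fiberOver f t) (2 * q), IsRationalClass c →
      IsOfHodgeType d (fiberOver f t) (2 * q) q q c → c ∈ algebraicClasses (fiberOver f t) q) :
    (∀ x : complexBetti 𝒳 (2 * q),
        fiberGysin hf t q (complexBetti.map (fiberι f t) (2 * q) x) ∈ algebraicClasses 𝒳 (q + 1) →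
        (∀ w ∈ algebraicClasses 𝒳 p, cupProduct (show 2 * (q + 1) + 2 * p = 2 * (d + 1) by omega)
            (fiberGysin hf t q (complexBetti.map (fiberι f t) (2 * q) x)) w = 0) →
          fiberGysin hf t q (complexBetti.map (fiberι f t) (2 * q) x) = 0) ↔
      ∀ b ∈ algebraicClasses (fiberOver f t) q,
        (∀ a ∈ algebraicClasses 𝒳 p,
          cupProduct (show 2 * p + 2 * (q + 1) = 2 * (d + 1) by omega) a (fiberGysin hf t q b) = 0) →
          fiberGysin hf t q b = 0 := by
  rw [numerical₂_iff_comap_le_sup_of_hodgeClassesAlgebraic hf t hpq hq,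
    numerical_iff_comap_le_sup_of_hodgeClassesAlgebraic hf t hpq hq]

end Summit.HodgeConjecture.HodgeConjecture.Ring2.AbelianAll

end
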